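import Mathlib
import HarnessLib
import HarnessLib.Audit
import Summits.MatrixMultiplication.Statement
import Literature.Computability.AlgebraicComplexity.MatrixMultiplicationExponent
import Literature.Computability.AlgebraicComplexity.SchoenhageTau
import Literature.Computability.AlgebraicComplexity.SchoenhageTauBini
import Literature.Computability.AlgebraicComplexity.FlatteningBound
import HarnessLib.Audit.Status.Attr

/-!
Route: ToricBorderRank

DORMANT since 2026-08-22T03:37:18Z (reconciler: no traction for 5 d (last activity item-evidence-added at 2026-08-17T02:18:10Z); parked, not closed — `ledger route dormant route-MatrixMultiplication-ToricBorderRank --off` to reactivate) — unstaffed, not closed; items shared with open routes are served there. `ledger route dormant <id> --off` reactivates.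

# Route ToricBorderRank — border rank of matrix multiplication without epsilon — honest rank with
chamber don't-cares, and Q* bR = R^λ

It suffices to show X = TORIC WITNESSES OF EXPONENT TWO (realises card
toric-border-rank-epsilon-free): for every ε > 0 there are
N ≥ 2, integer torus weights α, β, γ on the three index sets of ⟨N,N,N⟩ = matMulTensor ℂ N N N, and
an HONEST tensor T of the same
format with tensorRank T ≤ N^(2+ε), such that (W0) every support cell of ⟨N,N,N⟩ has weight α a + β
b + γ c = 0 and (W1) T agrees
with ⟨N,N,N⟩ on every cell of weight ≤ 0 — i.e. lim_(t→0) diag(t^α, t^β, t^γ)·T = ⟨N,N,N⟩: "matrix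
multiplication plus don't-cares
on the positive chamber of a stabiliser one-parameter subgroup has rank ≤ N^(2+ε)". Write R^λ(M) for
the least rank of such a toric
parent T of M. Then bR ≤ R^λ ≤ R (support item ToricDegeneration = BCS Prop. 15.30 read backwards,
and T = M with zero weights), so
X ⟺ ω(ℂ) = 2 with no loss; the content of the line is the conjecture Q* (crux BorderRankIsToric):
bR(⟨k,m,n⟩) = R^λ(⟨k,m,n⟩) for every
format — border rank of matrix multiplication needs no ε — which makes every border-rank upper bound
an exact, finite, Lean-checkable
rank identity with structured don't-cares, and (Hilbert–Mumford half, support HilbertMumfordHalf)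
identifies R^λ(⟨n,n,n⟩) with the
least honest rank in the S-equivalence class of ⟨n,n,n⟩.
Lean: `∀ ε : ℝ, 0 < ε → ∃ N : ℕ, 2 ≤ N ∧ ∃ (α : Fin N × Fin N → ℤ) (β : Fin N × Fin N → ℤ) (γ : Fin
N × Fin N → ℤ) (T : Fin N × Fin N → Fin N × Fin N → Fin N × Fin N → ℂ), (∀ a b c,
Literature.Computability.AlgebraicComplexity.matMulTensor ℂ N N N a b c ≠ 0 → α a + β b + γ c = 0) ∧
(∀ a b c, α a + β b + γ c ≤ 0 → T a b c = Literature.Computability.AlgebraicComplexity.matMulTensor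
ℂ N N N a b c) ∧ (Literature.Computability.AlgebraicComplexity.tensorRank T : ℝ) ≤ (N : ℝ) ^ (2 +
ε)`

## Assembly
Real-analysis bookkeeping only, PROVED sorry-free as `closes` in glue.lean (checked in the folder
Sketch.lean, axioms propext /
Classical.choice / Quot.sound): given ε > 0, ToricExponentTwo supplies N ≥ 2, weights and T with
tensorRank T ≤ N^(2+ε);
ToricDegeneration gives algBorderRank(⟨N,N,N⟩) ≤ tensorRank T ≤ r := max(R(T),1) ≤ N^(2+ε); Bini's
theorem, PROVED in the tree
(`Blaser2013_thm66_holds.cubic`), gives ω(ℂ) ≤ log_N r ≤ 2 + ε (Real.logb_le_logb_of_le,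
Real.logb_rpow); hence ω ≤ 2 by
le_of_forall_pos_le_add, and `omega_two_le ℂ` closes ω(ℂ) = 2 = MatrixMultiplication. The ranked
cruxes are the conjecture Q* and the
two finite toric cells that calibrate it — rungs of the mechanism, not premises of `closes` (the
accepted shape of an engine-plus-
conjecture route, cf. TropicalBiniPatterns / BrentRefutationDepth).

Rationale: WHY THIS LINE. Mechanism (card toric-border-rank-epsilon-free): a one-parameter-subgroup limit lim
λ(t)·T = M forces λ ⊂ Stab(M), and λ is
Stab(M)°-conjugate into the standard diagonal torus (Degroote1978: Stab(⟨k,m,n⟩)° is the image of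
GL_k×GL_m×GL_n), so the ε of an
approximate algorithm that IS a 1-PS orbit can be set to 1: T = M + garbage on the positive-weight
cells, an honest decomposition —
Bini–Capovani–Lotti–Romani's rank-5 scheme, Schönhage's ⟨e,1,ℓ⟩ ⊕ ⟨1,(e−1)(ℓ−1),1⟩ ≤ eℓ+1
(BurgisserClausenShokrollahi1997 (15.12),
Blaser2013 Lemma 7.1) and the W-state are of this form on the nose, and the card's numerics (kit
j000637–j000643) find real O(1) toric
parents at the border rank in every strict small case tried (⟨3,2,2⟩@10, ⟨4,2,2⟩@13, CW_q@q+2) and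
none for ⟨2,2,2⟩@6 (bR = 7,
Landsberg2005). Imported: geometric invariant theory (Hilbert–Mumford / Kempf–Ness,
MumfordFogartyKirwan1994, KempfNess1979,
BurgisserIkenmeyer2017 Prop. 2.8): ⟨n,n,n⟩ is SL³-polystable, so EVERY same-format tensor
degenerating to it under SL³ is, up to
SL³-translation, a toric parent of the same rank, whence R^λ(⟨n,n,n⟩) = min rank on the
S-equivalence class of ⟨n,n,n⟩ and Q* is the
precise statement "optimal border schemes for matrix multiplication never have to leave its
S-equivalence class"; combinatorial /
monomial degeneration (Strassen1987, BurgisserClausenShokrollahi1997 Def. 15.29,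
AlmanVassilevskaWilliams2018) so far runs FROM
auxiliary tensors TO matrix products, here it is read backwards as a normal form for border rank OF
⟨k,m,n⟩. What it does that prior
routes do not: TropicalBiniPatterns enumerates ε-valuation patterns of border schemes for direct
sums (keeps ε, per-term valuations,
Schönhage's τ-theorem); AsymptoticSpectrum / CatalyticDegeneration power or catalyse; this line
removes ε altogether for ⟨N,N,N⟩
itself (half the Brent equations become don't-cares, patterns collapse to chambers of a
(3N−3)-dimensional weight arrangement) and
stakes a falsifiable structural conjecture with a proved GIT half; negatives index empty at filing.

RANKED CRUXES. #0 ToricExponentTwo (target) — X as in § Thesis: for every ε > 0 some ⟨N,N,N⟩, N ≥ 2,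
has a toric parent (W0, W1 for integer diagonal weights) of honest rank ≤ N^(2+ε). (why it might
fail: Equivalent to ω(ℂ) = 2 (ToricDegeneration + Bini one way, zero weights the other): false if
any lower-bound route succeeds; and by CW82 strictness no single N certifies 2, so an infinite
family of toric identities is needed and none beyond Schönhage/CW-type is known.) [Blaser2013,
Bini1980, BurgisserClausenShokrollahi1997, CoppersmithWinograd1982]
#2 BorderRankIsToric (crux) — CONJECTURE Q* (card K1): for all k, m, n, r, if algBorderRank(⟨k,m,n⟩)
≤ r over ℂ then ⟨k,m,n⟩ has a toric parent of rank ≤ r in its own format: integer weights α, β, γ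
with (W0) on the support and an honest T with (W1) and tensorRank T ≤ r. Equivalently bR = R^λ for
every matrix multiplication tensor (the converse inequality is ToricDegeneration); with
HilbertMumfordHalf, for cubic formats: bR(⟨n,n,n⟩) = least rank on the S-equivalence class of
⟨n,n,n⟩. First open instances: ⟨3,3,3⟩ at 20 (ThreeCubedTwenty), 2·⟨2,2,2⟩ at its border rank, the
Kronecker square ⟨4,4,4⟩. [difficulty: open-problem] (why it might fail: σ_r is not one orbit
closure: a border family T_ε → ⟨n,n,n⟩ of rank-r tensors may keep ⟨n,n,n⟩ outside cl(SL³·T_ε) for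
every ε (each T_ε in another S-class, e.g. unstable), and the optimal CW-type schemes are non-toric
as printed; then bR < R^λ at some format.) [LandsbergMichalek2016Symmetry,
BurgisserClausenShokrollahi1997, MumfordFogartyKirwan1994, KempfNess1979,
AlmanVassilevskaWilliams2018, LandsbergGCT2017]
#3 TwoTwoThreeTen (crux) — R^λ(⟨2,2,3⟩) ≤ 10 (card's cheapest falsifier, passed numerically for the
⟨3,2,2⟩/⟨2,2,3⟩ orientations, kit j000637–j000640: real coefficients ≤ 3.4, residual 9e-16,
62-dimensional solution family, j000691): an honest rank-10 tensor agreeing with matMulTensor ℂ 2 2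
3 on the closed negative half-space of a stabiliser torus weight. With ToricDegeneration it
re-proves the BCLR bound bR(⟨2,2,3⟩) ≤ 10 (= bR by ConnerHarperLandsberg2023 Thm 1.3, < 11 = R,
Alekseyev) and Bini's ω ≤ 3 log_12 10 < 2.78 in the tree WITHOUT ε; a certificate is an explicit
rank-10 decomposition with algebraic entries, checkable by norm_num/decide. [difficulty: M] (why it
might fail: Only double-precision evidence: greedy rational snapping of the 62-dim family ends at
algebraic, not rational, points and a {0,±1} SAT search was still running at filing (j000701); if
the near-solutions are a numerical artefact, Q* dies at its first strict cell.)
[BiniCapovaniRomaniLotti1979, Bini1980, ConnerHarperLandsberg2023,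
ConnerGesmundoLandsbergVentura2022, HeuleKauersSeidl2021]
#4 ThreeCubedTwenty (crux) — R^λ(⟨3,3,3⟩) ≤ 20 (card K2, first half): Smirnov's border bound
bR(⟨3,3,3⟩) ≤ 20 is realised ε-free by an honest rank-20 tensor equal to matMulTensor ℂ 3 3 3 on the
closed negative half-space of some stabiliser torus weight (a 27×27×27 support pattern with half of
the 702 off-support cells free). Engine: exact rank search with chamber don't-cares (SAT over F_p à
la Heule–Kauers–Seidl, flip graphs, LM + LLL), lexicographic chambers first; a success is the first
ε-free certificate at 3×3 and the launch pad for 19. [deps: TwoTwoThreeTen] [difficulty: L] (why it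
might fail: Smirnov's schemes are non-toric as printed; all rank-20 parents of ⟨3,3,3⟩ may lie
outside its S-equivalence class (then, with bR ≤ 20, Q* is refuted); 9 chambers × 12 LM restarts
found nothing (j000644, residual 2e-5), and the right chamber may be one of ~1e10.) [Smirnov2013,
LandsbergGCT2017, HeuleKauersSeidl2021, KauersMoosbauer2022FlipGraphs,
ConnerGesmundoLandsbergVentura2022]
#9 ToricDegeneration (support) — THE DEGENERATION LEMMA (BCS Prop. 15.30 for the coordinate
decomposition, read backwards; card P1): over any commutative ring and finite formats, if integer
weights α, β, γ vanish on supp M (W0) and T = M on all cells of weight ≤ 0 (W1), then algBorderRank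
M ≤ tensorRank T — scale an optimal decomposition of T by ε^(α−min α), ε^(β−min β), ε^(γ−min γ) to
get an approximate decomposition of order h = −(min α+min β+min γ) (Bläser Def. 6.1). Gives bR ≤ R^λ
≤ R and is the hypothesis of `closes`. [difficulty: provable-now] [BurgisserClausenShokrollahi1997,
Blaser2013, Strassen1987]
#9 SchonhageToric (support) — SCHÖNHAGE'S τ-EXAMPLE IS TORIC (card P2): for e, ℓ ≥ 2 the direct sum
⟨e,1,ℓ⟩ ⊕ ⟨1,(e−1)(ℓ−1),1⟩ (matMulDirectSum ℂ ![e,1] ![1,(e−1)(ℓ−1)] ![ℓ,1]) has a toric parent of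
rank ≤ eℓ+1: T = Σ_ij (a_i+u_ij)⊗(b_j+v_ij)⊗(z_ij+w) − (Σa_i)⊗(Σb_j)⊗w with Schönhage's linear
constraints on u, v, weights 0 on a, b, z, 1 on u, v, −2 on w (the degree-0 and degree-1 parts of
BCS (15.12) cancel identically, so ε := 1 is legal). With ToricDegeneration and the proved τ-theorem
`Blaser2013_thm75_holds` this puts ω < 2.55 into the tree without ε. [difficulty: provable-now]
[Schonhage1981, BurgisserClausenShokrollahi1997, Blaser2013]
#9 HilbertMumfordHalf (support) — HILBERT–MUMFORD HALF (card half-theorem; structural, NOT a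
hypothesis of `closes`): for every n and every tensor T of the format of ⟨n,n,n⟩, ⟨n,n,n⟩ lies in
the Euclidean closure of the SL³-orbit of T (tree's actTensor, as in IsUnstable) iff some
SL³-translate of T is a toric parent of ⟨n,n,n⟩ (W0, W1 for integer diagonal weights). (⇐): the
weights act through SL³ up to a scalar t^s, and s = 0 because det∘flattening is an SL³-invariant not
vanishing at ⟨n,n,n⟩. (⇒): ⟨n,n,n⟩ is polystable (all flattening Gram matrices n·I, Kempf–Ness), so
its orbit is the closed orbit in cl(SL³·T) and the Hilbert–Mumford/Kempf–Birkes–Richardson criterion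
gives a 1-PS λ ⊂ SL³ with lim λ(t)T ∈ SL³·⟨n,n,n⟩; conjugate into Stab° (de Groote) and normalise
determinants (∏ det = 1 on Stab°). Corollary: R^λ(⟨n,n,n⟩) = min rank over the S-equivalence class
of ⟨n,n,n⟩. [difficulty: XL] [MumfordFogartyKirwan1994, KempfNess1979, BurgisserIkenmeyer2017,
Degroote1978, BlaserLysikov2020]

TWO-LAYER PLAN. Foreseen glued splits (none filed now; k ≤ 3, depth 1). BorderRankIsToric ⇐
LunaSliceToric (every irreducible component of
the affine cone σ̂_r through ⟨n,n,n⟩ meets the S-equivalence class π⁻¹(π(⟨n,n,n⟩)) in a tensor of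
rank ≤ r) → HilbertMumfordHalf →
BorderRankIsToric restricted to cubic formats; the rectangular formats then need their own
polystability/restriction glue (a toric
parent of ⟨N,N,N⟩ restricts to toric parents of sub-formats at no larger rank, but border rank of a
sub-format can be smaller), so a
resplit "cubic / rectangular" is the likely first edit. ThreeCubedTwenty ⇐ one chamber cell
(lexicographic α ≫ β ≫ γ, or a
ℤ₃-symmetric chamber) — alternative chambers are alternative proofs of the same statement, not
children. ToricExponentTwo ⇐ a
parametric toric family (a toric analogue of the CW/Schönhage constructions) → τ-bookkeeping via the
proved `Blaser2013_thm75_holds`,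
only once TwoTwoThreeTen and ThreeCubedTwenty have shown what certified toric witnesses look like.

KILL CRITERIA. A proof of ¬ThreeCubedTwenty (no toric rank-20 parent of ⟨3,3,3⟩ in any chamber)
together with Smirnov's bR(⟨3,3,3⟩) ≤ 20
(`LandsbergGCT2017_borderRank_matMulTensor_three`) refutes BorderRankIsToric: close
`refuted:BorderRankIsToric` unless Q* survives for
cubic formats n ≥ 4 in a form worth restating (pivot: "bR(⟨n,n,n⟩) = R^λ(⟨n,n,n⟩) for all n ≥ n₀",
which still gives X ⟺ border-rank
exponent 2). ¬TwoTwoThreeTen (certified infeasibility over all chambers at ⟨2,2,3⟩@10, bR = 10 by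
CHL23 Thm 1.3) kills Q* at its first
strict cell: close `refuted:BorderRankIsToric` outright. Any superquadratic border-rank lower bound
for ⟨n,n,n⟩ (route
BorderRankLowerBound) or ω > 2 refutes ToricExponentTwo and every positive route. ω = 2 proved
elsewhere moots the route (X follows with
zero weights).

NOT DECOMPOSED YET. The attack cell R^λ(⟨3,3,3⟩) ≤ 19 (new border bound; shares the cell with
TropicalBiniPatterns.ThreeByThreeNineteen, which a toric 19
would imply via ToricDegeneration) — filed only after ThreeCubedTwenty closes; the lower-bound
reading (card K3: min over chambers of
R(⟨2,2,2⟩ + G_C) = 7 by the substitution method, an ε-free proof of a border fact, and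
uniform-in-garbage substitution bounds for
⟨n,n,n⟩ + G_C beyond 2n², which bound BORDER rank only under Q*) — belongs to route
BorderRankLowerBound once Q* has evidence at 3×3;
Q*_tight (the same for all tight tensors); toricity of CW_q at q+2 and of the Kronecker squares; the
chamber-enumeration engine
itself (symmetry classes of the weight arrangement for n = 3) — kit work attached to
ThreeCubedTwenty, not items; Literature facts for
the Hilbert–Mumford criterion on V₁⊗V₂⊗V₃ and de Groote's isotropy theorem (to be requested as cite
items when a prover takes
HilbertMumfordHalf).

CHEAPEST FALSIFIER. TwoTwoThreeTen itself: certify (exact arithmetic, rational or low-degree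
algebraic entries) one rank-10 toric parent of ⟨2,2,3⟩ in the
lexicographic chamber found numerically by the card (kit j000637–j000640, residual 9e-16,
coefficients ≤ 3.4; SAT search for a
{0,±1} witness j000701 was running at filing and re-finds BCLR's reduced-product witness in 0.3 s,
j000700). I could not re-run kit
from this seat; the exact BCLR and Schönhage toric identities were checked by the card in rational
arithmetic (toric_classical.py) and
Schönhage's re-derived by hand here (weights a,b ↦ 0, u,v ↦ 1, z ↦ 0, w ↦ −2). Refuters: run the
⟨2,2,3⟩@10 certification first; a
certified infeasibility over all 6!·4!·6!-many chamber classes kills the line.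

NUMBERS. bR(⟨2,2,2⟩) = 7 = R (Landsberg2005; HauensteinIkenmeyerLandsberg2013) — toric search at 6
fails in all 24 chambers (control, j000643).
bR(⟨2,2,3⟩) = 10 (ConnerHarperLandsberg2023 Thm 1.3) < 11 = R; toric 10 found numerically.
bR(⟨4,2,2⟩) ≤ 13 < 14: toric 13 found
numerically (j000641). 17 ≤ bR(⟨3,3,3⟩) ≤ 20 (ConnerHarperLandsberg2023 Thm 1.1, Smirnov2013), 19 ≤
R(⟨3,3,3⟩) ≤ 23: toric 20 open.
bR(⟨n,n,n⟩) ≥ 2n² − ⌈log₂ n⌉ − 1 (LandsbergMichalek2018), hence R^λ ≥ the same. Exponents reachable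
ε-free once certified: 3 log_12 10
= 2.7799 (TwoTwoThreeTen + Bini), < 2.55 (SchonhageToric + τ-theorem, e = ℓ = 4: 16^τ + 9^τ = 17).
Items at open: 8.

DEFINITION REQUESTS. None needed to state the items (toric parents are inlined over matMulTensor /
matMulDirectSum / tensorRank / algBorderRank / actTensor).
Cite facts to request when HilbertMumfordHalf is taken: the Hilbert–Mumford criterion for
SL(V₁)×SL(V₂)×SL(V₃) on V₁⊗V₂⊗V₃ reaching the
closed orbit (MumfordFogartyKirwan1994 Thm 2.1 / Kempf 1978), and de Groote's isotropy group of
⟨k,m,n⟩ (Degroote1978). A named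
definition `toricRank` (R^λ) would shorten every item but is deliberately not requested before
TwoTwoThreeTen lands.

Novelty: Searches (2026-08-15): `lit search` local/hybrid ×2 ("border rank one-parameter subgroup limit rank
decomposition matrix
multiplication", "monomial degeneration border rank matrix multiplication tensor torus") rc 75 —
searchd unavailable all session;
`lit search --source zbmath` ×8: "monomial degeneration matrix multiplication tensor" (3:
arXiv:1712.07246, arXiv:1810.08671 — the
method direction), "degeneration one-parameter subgroup border rank tensor" (0), "border rank matrix
multiplication symmetry" (4:
arXiv:1601.08229, arXiv:1911.07981, doi:10.1017/fmp.2023.14, arXiv:1912.13174), "degeneration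
tensors closed orbit" (1, unrelated),
"combinatorial degeneration matrix multiplication" (4: arXiv:1709.07851, arXiv:2111.08262, two
unrelated), "approximate algorithms
matrix multiplication exact algorithms relations" (10: doi:10.1007/bf02575865 Bini 1980 +
proceedings noise), "tight tensors border
rank" (4: arXiv:1811.05511, arXiv:2002.09472, arXiv:2604.19872, arXiv:1504.08049), "Kempf Ness
tensor rank" (1: arXiv:2511.12064);
`lit search --source arxiv` (0), openalex/s2 (HTTP 429); `lit galaxy search --star all` ×2 ("border
rank matrix multiplication
one-parameter subgroup": 0; "monomial degeneration": 3 pdf rows — matching-field ideals,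
Ardila–Boocher, CVZ graph tensors) and
`--star pdf "toric degeneration"` (30 rows, all toric degenerations of varieties, none on tensor
border rank); `lit read
doi:10.1007/978-3-662-03338-8 --grep "combinatorial degeneration"` (pp. 426–427 Def. 1  [refs: 10.1017/fmp.2023.14, 10.1007/bf02575865, 10.1007/978-3-662-03338-8, 1712.07246, 1810.08671, 1601.08229, 1911.07981, 1912.13174, 1709.07851, 2111.08262, 1811.05511, 2002.09472, 2604.19872, 1504.08049, 2511.12064, doi:10.1017/fmp.2023.14, doi:10.1007/bf02575865, doi:10.1007/978-3-662-03338-8, BurgisserClausenShokrollahi1997, AlmanVassilevskaWilliams2018, Bini1980, BiniCapovaniRomaniLotti1979, Schonh]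

Barriers (technique_class: monomial-degeneration, border-rank-normal-form, exact-search): - technique_class: monomial-degeneration, border-rank-normal-form, exact-search
- Literature.Barriers.MatrixMultiplication.InfimumNotMinimumBarrier: respected, not evaded — X
quantifies over N; each toric witness is one finite identity certifying only ω ≤ log_N r (> 2 by
CW82 strictness / bR ≥ 2N² − log N − 1), and Q* concerns equality bR = R^λ format by format, which
the barrier does not touch.
- Literature.Barriers.MatrixMultiplication.UniversalMethodBarrier: not in class — no fixed
intermediate tensor is powered and no value/ASI bookkeeping occurs; monomial degeneration runs from
an arbitrary rank-r tensor chosen anew per format ONTO ⟨N,N,N⟩ itself; conceded that pointing the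
engine at CW-powers as sources would re-enter the class (ω_u(CW_q) ≥ 2.17).
- Literature.Barriers.MatrixMultiplication.IrreversibilityBarrier: not in class for the same reason
(no intermediate tensor whose irreversibility caps the bound); the parents T are not required to be
reversible, and their asymptotic data never enters.
- Literature.Barriers.MatrixMultiplication.UnstableTensorBarrier: not in class — parents T are
arbitrary (by HilbertMumfordHalf the relevant ones are S-equivalent to the POLYSTABLE ⟨n,n,n⟩, the
opposite of unstable/minimal-border-rank starting tensors).
- Literature.Barriers.MatrixMultiplication.RectangularBarrier: not in class (no T-method;
rectangular ⟨k,m,n⟩ appear only as targets of Q*).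
- Literature.Barriers.MatrixMultiplication.LinearRankMethodBarrier: bears only on the def

Novelty grade: new-combination — ROUTE REVIEW (refuter rreview-0815T14-14) VERDICT ok. Grade mirrors card triage; my search: searchd rc75, zbMATH x3 (new pointer arXiv:2212.14095), negatives MM 0. CHECKS: all 8 decls elaborate (W1.lean rc0); defs honest (ranks = sInf over K[eps] decompositions, junk 0 only for infinite index types; (refuter refuter-rreview-0815T14-14-0, 2026-08-15T15:25:35Z; prior: doi:10.1007/978-3-662-03338-8 (BCS Def 15.29-Prop 15.30); arXiv:1712.07246 (AVW); arXiv:1601.08229 (LM); KempfNess1979/MumfordFogartyKirwan1994 (HM closed orbits only); arXiv:2212.14095 (CGLS partial degeneration, reading for Q*))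

History (route lifecycle, newest last):
- 2026-08-16T04:11:33Z · AUTO-CRUX (backfill): ToricExponentTwo — hypotheses of the deciding theorem that nothing in the route derives are cruxes (operator:999:1085951)
- 2026-08-22T03:37:18Z · DORMANT — reconciler: no traction for 5 d (last activity item-evidence-added at 2026-08-17T02:18:10Z); parked, not closed — `ledger route dormant route-MatrixMultiplicati (operator:999:795940)

sub-problem: MatrixMultiplication · status: dormant · opened planner-plancard-MatrixMultiplication-MatrixM-a6189c99-0 2026-08-15T14:58:11Z · rev 1 · ledger route-MatrixMultiplication-ToricBorderRank
GENERATED by the gate from the ledger (D-0016/17). Provers cite these decls: `theorem foo : Summit.MatrixMultiplication.MatrixMultiplication.Theses.ToricBorderRank.<Decl> := …` in Summits/MatrixMultiplication/MatrixMultiplication/Theorems/<Name>.lean.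
-/

namespace Summit.MatrixMultiplication.MatrixMultiplication.Theses.ToricBorderRank

open scoped BigOperators Topology Manifold Classical MeasureTheory ProbabilityTheory Matrix InnerProductSpace ComplexConjugate ContinuousMap
open Filter Set Function TopologicalSpace MeasureTheory

attribute [summit_statement] _root_.MatrixMultiplication

/-- item stmt-MatrixMultiplication-9962 · crux (kind.auto-crux: conjecture-grade) · rank 0 · open · by planner
why it might fail: Equivalent to ω(ℂ) = 2 (ToricDegeneration + Bini one way, zero weights the other): false if any lower-bound route succeeds; and by CW82 strictness no single N certifies 2, so an infinite family of toric identities is needed and none beyond Schönhage/CW-type is known.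
sources: Blaser2013, Bini1980, BurgisserClausenShokrollahi1997, CoppersmithWinograd1982
[target] X as in § Thesis: for every ε > 0 some ⟨N,N,N⟩, N ≥ 2, has a toric parent (W0, W1 for
integer diagonal weights) of honest rank ≤ N^(2+ε). -/
@[route_item "route-MatrixMultiplication-ToricBorderRank", crux]
def ToricExponentTwo : Prop :=
  ∀ ε : ℝ, 0 < ε → ∃ N : ℕ, 2 ≤ N ∧ ∃ (α : Fin N × Fin N → ℤ) (β : Fin N × Fin N → ℤ) (γ : Fin N × Fin N → ℤ) (T : Fin N × Fin N → Fin N × Fin N → Fin N × Fin N → ℂ), (∀ a b c, Literature.Computability.AlgebraicComplexity.matMulTensor ℂ N N N a b c ≠ 0 → α a + β b + γ c = 0) ∧ (∀ a b c, α a + β b + γ c ≤ 0 → T a b c = Literature.Computability.AlgebraicComplexity.matMulTensor ℂ N N N a b c) ∧ (Literature.Computability.AlgebraicComplexity.tensorRank T : ℝ) ≤ (N : ℝ) ^ (2 + ε)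

/-- item stmt-MatrixMultiplication-9963 · crux · rank 2 · open · by planner
why it might fail: σ_r is not one orbit closure: a border family T_ε → ⟨n,n,n⟩ of rank-r tensors may keep ⟨n,n,n⟩ outside cl(SL³·T_ε) for every ε (each T_ε in another S-class, e.g. unstable), and the optimal CW-type schemes are non-toric as printed; then bR < R^λ at some format.
sources: LandsbergMichalek2016Symmetry, BurgisserClausenShokrollahi1997, MumfordFogartyKirwan1994, KempfNess1979, AlmanVassilevskaWilliams2018, LandsbergGCT2017
[crux] CONJECTURE Q* (card K1): for all k, m, n, r, if algBorderRank(⟨k,m,n⟩) ≤ r over ℂ then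
⟨k,m,n⟩ has a toric parent of rank ≤ r in its own format: integer weights α, β, γ with (W0) on the
support and an honest T with (W1) and tensorRank T ≤ r. Equivalently bR = R^λ for every matrix
multiplication tensor (the converse inequality is ToricDegeneration); with HilbertMumfordHalf, for
cubic formats: bR(⟨n,n,n⟩) = least rank on the S-equivalence class of ⟨n,n,n⟩. First open instances:
⟨3,3,3⟩ at 20 (ThreeCubedTwenty), 2·⟨2,2,2⟩ at its border rank, the Kronecker square ⟨4,4,4⟩.
[difficulty: open-problem] -/
@[route_item "route-MatrixMultiplication-ToricBorderRank"]
def BorderRankIsToric : Prop :=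
  ∀ (k m n r : ℕ), Literature.Computability.AlgebraicComplexity.algBorderRank (Literature.Computability.AlgebraicComplexity.matMulTensor ℂ k m n) ≤ r → ∃ (α : Fin k × Fin n → ℤ) (β : Fin k × Fin m → ℤ) (γ : Fin m × Fin n → ℤ) (T : Fin k × Fin n → Fin k × Fin m → Fin m × Fin n → ℂ), (∀ a b c, Literature.Computability.AlgebraicComplexity.matMulTensor ℂ k m n a b c ≠ 0 → α a + β b + γ c = 0) ∧ (∀ a b c, α a + β b + γ c ≤ 0 → T a b c = Literature.Computability.AlgebraicComplexity.matMulTensor ℂ k m n a b c) ∧ Literature.Computability.AlgebraicComplexity.tensorRank T ≤ r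

/-- item stmt-MatrixMultiplication-9964 · crux · rank 3 · open · by planner
why it might fail: Only double-precision evidence: greedy rational snapping of the 62-dim family ends at algebraic, not rational, points and a {0,±1} SAT search was still running at filing (j000701); if the near-solutions are a numerical artefact, Q* dies at its first strict cell.
sources: BiniCapovaniRomaniLotti1979, Bini1980, ConnerHarperLandsberg2023, ConnerGesmundoLandsbergVentura2022, HeuleKauersSeidl2021
[crux] R^λ(⟨2,2,3⟩) ≤ 10 (card's cheapest falsifier, passed numerically for the ⟨3,2,2⟩/⟨2,2,3⟩
orientations, kit j000637–j000640: real coefficients ≤ 3.4, residual 9e-16, 62-dimensional solution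
family, j000691): an honest rank-10 tensor agreeing with matMulTensor ℂ 2 2 3 on the closed negative
half-space of a stabiliser torus weight. With ToricDegeneration it re-proves the BCLR bound
bR(⟨2,2,3⟩) ≤ 10 (= bR by ConnerHarperLandsberg2023 Thm 1.3, < 11 = R, Alekseyev) and Bini's ω ≤ 3
log_12 10 < 2.78 in the tree WITHOUT ε; a certificate is an explicit rank-10 decomposition with
algebraic entries, checkable by norm_num/decide. [difficulty: M] -/
@[route_item "route-MatrixMultiplication-ToricBorderRank"]
def TwoTwoThreeTen : Prop :=
  ∃ (α : Fin 2 × Fin 3 → ℤ) (β : Fin 2 × Fin 2 → ℤ) (γ : Fin 2 × Fin 3 → ℤ) (T : Fin 2 × Fin 3 → Fin 2 × Fin 2 → Fin 2 × Fin 3 → ℂ), (∀ a b c, Literature.Computability.AlgebraicComplexity.matMulTensor ℂ 2 2 3 a b c ≠ 0 → α a + β b + γ c = 0) ∧ (∀ a b c, α a + β b + γ c ≤ 0 → T a b c = Literature.Computability.AlgebraicComplexity.matMulTensor ℂ 2 2 3 a b c) ∧ Literature.Computability.AlgebraicComplexity.tensorRank T ≤ 10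

/-- item stmt-MatrixMultiplication-9965 · crux · rank 4 · open · by planner
why it might fail: Smirnov's schemes are non-toric as printed; all rank-20 parents of ⟨3,3,3⟩ may lie outside its S-equivalence class (then, with bR ≤ 20, Q* is refuted); 9 chambers × 12 LM restarts found nothing (j000644, residual 2e-5), and the right chamber may be one of ~1e10.
sources: Smirnov2013, LandsbergGCT2017, HeuleKauersSeidl2021, KauersMoosbauer2022FlipGraphs, ConnerGesmundoLandsbergVentura2022
[crux] R^λ(⟨3,3,3⟩) ≤ 20 (card K2, first half): Smirnov's border bound bR(⟨3,3,3⟩) ≤ 20 is realised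
ε-free by an honest rank-20 tensor equal to matMulTensor ℂ 3 3 3 on the closed negative half-space
of some stabiliser torus weight (a 27×27×27 support pattern with half of the 702 off-support cells
free). Engine: exact rank search with chamber don't-cares (SAT over F_p à la Heule–Kauers–Seidl,
flip graphs, LM + LLL), lexicographic chambers first; a success is the first ε-free certificate at
3×3 and the launch pad for 19. [deps: TwoTwoThreeTen] [difficulty: L] -/
@[route_item "route-MatrixMultiplication-ToricBorderRank"]
def ThreeCubedTwenty : Prop :=
  ∃ (α : Fin 3 × Fin 3 → ℤ) (β : Fin 3 × Fin 3 → ℤ) (γ : Fin 3 × Fin 3 → ℤ) (T : Fin 3 × Fin 3 → Fin 3 × Fin 3 → Fin 3 × Fin 3 → ℂ), (∀ a b c, Literature.Computability.AlgebraicComplexity.matMulTensor ℂ 3 3 3 a b c ≠ 0 → α a + β b + γ c = 0) ∧ (∀ a b c, α a + β b + γ c ≤ 0 → T a b c = Literature.Computability.AlgebraicComplexity.matMulTensor ℂ 3 3 3 a b c) ∧ Literature.Computability.AlgebraicComplexity.tensorRank T ≤ 20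

/-- item stmt-MatrixMultiplication-9966 · support · rank 9 · closed · proved by Summit.MatrixMultiplication.MatrixMultiplication.Theorems.toricDegeneration_proof (prover) · by planner
sources: BurgisserClausenShokrollahi1997, Blaser2013, Strassen1987
[support] THE DEGENERATION LEMMA (BCS Prop. 15.30 for the coordinate decomposition, read backwards;
card P1): over any commutative ring and finite formats, if integer weights α, β, γ vanish on supp M
(W0) and T = M on all cells of weight ≤ 0 (W1), then algBorderRank M ≤ tensorRank T — scale an
optimal decomposition of T by ε^(α−min α), ε^(β−min β), ε^(γ−min γ) to get an approximate
decomposition of order h = −(min α+min β+min γ) (Bläser Def. 6.1). Gives bR ≤ R^λ ≤ R and is the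
hypothesis of `closes`. [difficulty: provable-now] -/
@[route_item "route-MatrixMultiplication-ToricBorderRank", crux]
def ToricDegeneration : Prop :=
  ∀ (K : Type) [CommRing K] (ι κ μ : Type) [Fintype ι] [Fintype κ] [Fintype μ] [DecidableEq ι] [DecidableEq κ] [DecidableEq μ] (M T : ι → κ → μ → K) (α : ι → ℤ) (β : κ → ℤ) (γ : μ → ℤ), (∀ a b c, M a b c ≠ 0 → α a + β b + γ c = 0) → (∀ a b c, α a + β b + γ c ≤ 0 → T a b c = M a b c) → Literature.Computability.AlgebraicComplexity.algBorderRank M ≤ Literature.Computability.AlgebraicComplexity.tensorRank T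

/-- item stmt-MatrixMultiplication-9967 · support · rank 9 · closed · proved by Summit.MatrixMultiplication.MatrixMultiplication.Theorems.schonhageToric_proof @ 33744b09b114 (prover) · by planner
sources: Schonhage1981, BurgisserClausenShokrollahi1997, Blaser2013
[support] SCHÖNHAGE'S τ-EXAMPLE IS TORIC (card P2): for e, ℓ ≥ 2 the direct sum ⟨e,1,ℓ⟩ ⊕
⟨1,(e−1)(ℓ−1),1⟩ (matMulDirectSum ℂ ![e,1] ![1,(e−1)(ℓ−1)] ![ℓ,1]) has a toric parent of rank ≤
eℓ+1: T = Σ_ij (a_i+u_ij)⊗(b_j+v_ij)⊗(z_ij+w) − (Σa_i)⊗(Σb_j)⊗w with Schönhage's linear constraints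
on u, v, weights 0 on a, b, z, 1 on u, v, −2 on w (the degree-0 and degree-1 parts of BCS (15.12)
cancel identically, so ε := 1 is legal). With ToricDegeneration and the proved τ-theorem
`Blaser2013_thm75_holds` this puts ω < 2.55 into the tree without ε. [difficulty: provable-now] -/
@[route_item "route-MatrixMultiplication-ToricBorderRank"]
def SchonhageToric : Prop :=
  ∀ e l : ℕ, 2 ≤ e → 2 ≤ l → ∃ (α : (Σ i : Fin 2, Fin (![e, 1] i) × Fin (![l, 1] i)) → ℤ) (β : (Σ i : Fin 2, Fin (![e, 1] i) × Fin (![1, (e - 1) * (l - 1)] i)) → ℤ) (γ : (Σ i : Fin 2, Fin (![1, (e - 1) * (l - 1)] i) × Fin (![l, 1] i)) → ℤ) (T : (Σ i : Fin 2, Fin (![e, 1] i) × Fin (![l, 1] i)) → (Σ i : Fin 2, Fin (![e, 1] i) × Fin (![1, (e - 1) * (l - 1)] i)) → (Σ i : Fin 2, Fin (![1, (e - 1) * (l - 1)] i) × Fin (![l, 1] i)) → ℂ), (∀ a b c, Literature.Computability.AlgebraicComplexity.matMulDirectSum ℂ ![e, 1] ![1, (e - 1) * (l - 1)] ![l, 1]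 a b c ≠ 0 → α a + β b + γ c = 0) ∧ (∀ a b c, α a + β b + γ c ≤ 0 → T a b c = Literature.Computability.AlgebraicComplexity.matMulDirectSum ℂ ![e, 1] ![1, (e - 1) * (l - 1)] ![l, 1] a b c) ∧ Literature.Computability.AlgebraicComplexity.tensorRank T ≤ e * l + 1

/-- item stmt-MatrixMultiplication-9968 · support · rank 9 · open · by planner
sources: MumfordFogartyKirwan1994, KempfNess1979, BurgisserIkenmeyer2017, Degroote1978, BlaserLysikov2020
[support] HILBERT–MUMFORD HALF (card half-theorem; structural, NOT a hypothesis of `closes`): for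
every n and every tensor T of the format of ⟨n,n,n⟩, ⟨n,n,n⟩ lies in the Euclidean closure of the
SL³-orbit of T (tree's actTensor, as in IsUnstable) iff some SL³-translate of T is a toric parent of
⟨n,n,n⟩ (W0, W1 for integer diagonal weights). (⇐): the weights act through SL³ up to a scalar t^s,
and s = 0 because det∘flattening is an SL³-invariant not vanishing at ⟨n,n,n⟩. (⇒): ⟨n,n,n⟩ is
polystable (all flattening Gram matrices n·I, Kempf–Ness), so its orbit is the closed orbit in
cl(SL³·T) and the Hilbert–Mumford/Kempf–Birkes–Richardson criterion gives a 1-PS λ ⊂ SL³ with lim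
λ(t)T ∈ SL³·⟨n,n,n⟩; conjugate into Stab° (de Groote) and normalise determinants (∏ det = 1 on
Stab°). Corollary: R^λ(⟨n,n,n⟩) = min rank over the S-equivalence class of ⟨n,n,n⟩. [difficulty: XL] -/
@[route_item "route-MatrixMultiplication-ToricBorderRank"]
def HilbertMumfordHalf : Prop :=
  ∀ (n : ℕ) (T : Fin n × Fin n → Fin n × Fin n → Fin n × Fin n → ℂ), Literature.Computability.AlgebraicComplexity.matMulTensor ℂ n n n ∈ closure (Set.range fun g : Matrix.SpecialLinearGroup (Fin n × Fin n) ℂ × Matrix.SpecialLinearGroup (Fin n × Fin n) ℂ × Matrix.SpecialLinearGroup (Fin n × Fin n) ℂ => (fun a b c => ∑ a', ∑ b', ∑ c', (g.1 : Matrix (Fin n × Fin n) (Fin n × Fin n) ℂ) a a' * (g.2.1 : Matrix (Fin n × Fin n) (Fin n × Fin n) ℂ) b b' * (g.2.2 : Matrix (Fin n × Fin n) (Fin n × Fin n) ℂ) c c' * T a' b' c')) ↔ ∃ (g : Matrix.SpecialLinearGroup (Fin n × Fin n) ℂ × Matrix.SpecialLinearGroup (Fin n × Fin n) ℂ × Matrix.SpecialLinearGroup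 (Fin n × Fin n) ℂ) (α β γ : Fin n × Fin n → ℤ), (∀ a b c, Literature.Computability.AlgebraicComplexity.matMulTensor ℂ n n n a b c ≠ 0 → α a + β b + γ c = 0) ∧ (∀ a b c, α a + β b + γ c ≤ 0 → ∑ a', ∑ b', ∑ c', (g.1 : Matrix (Fin n × Fin n) (Fin n × Fin n) ℂ) a a' * (g.2.1 : Matrix (Fin n × Fin n) (Fin n × Fin n) ℂ) b b' * (g.2.2 : Matrix (Fin n × Fin n) (Fin n × Fin n) ℂ) c c' * T a' b' c' = Literature.Computability.AlgebraicComplexity.matMulTensor ℂ n n n a b c)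

/-- item stmt-MatrixMultiplication-9969 · assembly · rank 1 · closed · proved by Summit.MatrixMultiplication.MatrixMultiplication.Theorems.toricBorderRank_assembly_proof @ e539d5869d69 (prover) · by planner
sources: Blaser2013, Bini1980
[assembly] ToricExponentTwo → ToricDegeneration → ω(ℂ) = 2. -/
@[route_item "route-MatrixMultiplication-ToricBorderRank"]
def Assembly : Prop :=
  ToricExponentTwo → ToricDegeneration → MatrixMultiplication

/-! D-0027 §2.1 — DECIDING THEOREM (planner-authored via `route open/edit --closes-file`; by planner-plancard-MatrixMultiplication-MatrixM-a6189c99-0 2026-08-15T14:58:12Z):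
its hypotheses are this route's items and its conclusion the sub-problem Statement (glue_lint), and it elaborates with this file. -/

/-- DECIDING THEOREM (D-0027 §2.1): toric witnesses of exponent two (`ToricExponentTwo`) and the
toric degeneration lemma (`ToricDegeneration`, BCS Prop. 15.30 read backwards) decide `ω(ℂ) = 2`:
for `ε > 0` take `N ≥ 2`, weights and an honest `T` with `R(T) ≤ N^(2+ε)`; the lemma gives
`bR(⟨N,N,N⟩) ≤ R(T) ≤ r := max (R T) 1 ≤ N^(2+ε)`, Bini's theorem (PROVED in tree,
`Blaser2013_thm66_holds.cubic`) gives `ω(ℂ) ≤ log_N r ≤ 2 + ε`, and `omega_two_le ℂ` closes. -/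
@[closes "route-MatrixMultiplication-ToricBorderRank"] theorem closes (hX : ToricExponentTwo) (hD : ToricDegeneration) : MatrixMultiplication := by
  show Literature.Computability.AlgebraicComplexity.omega ℂ = 2
  refine le_antisymm ?_ (Literature.Computability.AlgebraicComplexity.omega_two_le ℂ)
  refine le_of_forall_pos_le_add fun ε hε => ?_
  obtain ⟨N, hN, α, β, γ, T, h0, h1, hT⟩ := hX ε hε
  have hbr : Literature.Computability.AlgebraicComplexity.algBorderRank
      (Literature.Computability.AlgebraicComplexity.matMulTensor ℂ N N N) ≤
      Literature.Computability.AlgebraicComplexity.tensorRank T :=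
    hD ℂ (Fin N × Fin N) (Fin N × Fin N) (Fin N × Fin N)
      (Literature.Computability.AlgebraicComplexity.matMulTensor ℂ N N N) T α β γ h0 h1
  set r : ℕ := max (Literature.Computability.AlgebraicComplexity.tensorRank T) 1 with hr
  have hr1 : 1 ≤ r := le_max_right _ _
  have hbr' : Literature.Computability.AlgebraicComplexity.algBorderRank
      (Literature.Computability.AlgebraicComplexity.matMulTensor ℂ N N N) ≤ r :=
    hbr.trans (le_max_left _ _)
  have hω : Literature.Computability.AlgebraicComplexity.omega ℂ ≤ Real.logb N r :=
    Literature.Computability.AlgebraicComplexity.Blaser2013_thm66_holds.cubic ℂ hN hr1 hbr'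
  have hN1 : (1 : ℝ) < N := by exact_mod_cast (lt_of_lt_of_le (by norm_num) hN)
  have hNpow : (1 : ℝ) ≤ (N : ℝ) ^ (2 + ε) := Real.one_le_rpow hN1.le (by linarith)
  have hrle : (r : ℝ) ≤ (N : ℝ) ^ (2 + ε) := by
    rcases le_total (Literature.Computability.AlgebraicComplexity.tensorRank T) 1 with h | h
    · have : r = 1 := by rw [hr]; exact max_eq_right h
      rw [this]; simpa using hNpow
    · have : r = Literature.Computability.AlgebraicComplexity.tensorRank T := by
        rw [hr]; exact max_eq_left h
      rw [this]; exact hT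
  have hrpos : (0 : ℝ) < r := by exact_mod_cast hr1
  calc Literature.Computability.AlgebraicComplexity.omega ℂ ≤ Real.logb N r := hω
    _ ≤ Real.logb N ((N : ℝ) ^ (2 + ε)) := Real.logb_le_logb_of_le hN1 hrpos hrle
    _ = 2 + ε := Real.logb_rpow (by linarith) (ne_of_gt hN1)

end Summit.MatrixMultiplication.MatrixMultiplication.Theses.ToricBorderRank
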